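import Summits.CriticalPhenomena.PercolationContinuityZ3.Theorems.FK.MagnetizationLargeDeviations
import Summits.CriticalPhenomena.PercolationContinuityZ3.Theorems.FK.IsingPhaseDiagram
import Literature.Probability.LatticeModels.GibbsEnergyBounds
import HarnessLib

/-!
# CONCENTRATION OF THE MAGNETISATION DENSITY UNIFORMLY IN THE BOUNDARY CONDITION: `ψ^{bc}_{Λ_N} → ψ` UNIFORMLY IN `bc`
# (`|ψ^{bc}_Λ − ψ^∅_Λ| ≤ |β||∂ᵉΛ|/|Λ|`), HENCE THE LARGE-DEVIATION UPPER BOUNDS AND THE EXPONENTIAL LAW OF LARGE NUMBERS HOLD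
# WITH ONE `N₀` FOR ALL BOUNDARY CONDITIONS AT ONCE (Ellis 2006 Thm. II.6.3; Olla 1988 Thm. 5.2 «uniformly for any ω′»)

Claimed R42 (8)(c) in the cell INBOX at 2026-08-29T09:47:37Z by fkp-10a gen 359 (NEW CLAIM #8 of the gen), addressed to the lane under (ι) (coordinator fk-4 gen 294 CLOSED l.8860 09:37:04Z; «(ι) RESUMES») and to the next seated fk-4 generation (ruling R179 requested); lineage row FO-10a-g359u (self-suggested), package g359-uniform, label LD-I.
Helper file of the `fk-continuity` build cell (bschramm lane; `--supports stmt-CriticalPhenomena-4575`); builds on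
p205010 (kernel theorem, internal audit signed; external expert review pending). No definitions, no named facts, no
sorries; standard axioms. UNCONDITIONAL (nearest-neighbour Ising model on `ℤ^d`, boxes `Λ_N`; `μ_N = μ^{bc}_{Λ_N;β,h}`,
`M_N = Σ_{x∈Λ_N} σ_x`).  The files `MagnetizationLargeDeviations` / `MagnetizationExponentialLLN` give, for every fixed
boundary condition, bounds holding eventually in `N`; here the order of quantifiers is improved to «eventually in `N`, for
ALL boundary conditions simultaneously» — free, `±`, or `fixed η` for ANY of the uncountably many `η` — using the
boundary estimate of Friedli–Velenik's proof of Thm. 3.6 (`|log Z^{bc}_Λ − log Z^∅_Λ| ≤ |β||∂ᵉΛ|`, Literature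
`abs_log_isingPartitionFunction_div_sub_free_div_le`) and `|∂ᵉΛ_N|/|Λ_N| → 0`:

* `abs_pressureIn_sub_pressureIn_free_le` — `|ψ^{bc}_Λ(β,h) − ψ^∅_Λ(β,h)| ≤ |β| |∂ᵉΛ|/|Λ|` (any graph);
* **`eventually_forall_bc_abs_pressureIn_sub_pressure_lt`** — `ψ^{bc}_{Λ_N}(β,h) → ψ(β,h)` UNIFORMLY in `bc`;
* **`eventually_forall_bc_measureReal_le_sum_spinAt_le`** / `…_sum_spinAt_le_le` — the LD UPPER bounds for half-lines
  with one `N₀` for all `bc`;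
* `upper_tail_exp_decay_uniform_of_hasDerivWithinAt`, `lower_tail_exp_decay_uniform_of_hasDerivWithinAt`,
  **`exp_concentration_uniform_of_hasDerivAt`** — exponential concentration at `ψ'(h)/β`, `∀ᶠ N, ∀ bc`;
* Ising specialisations: **`exp_concentration_uniform_pos_field`** (`h > 0`: at `m(β,h)`),
  **`upper_tail_exp_decay_uniform_of_spontaneousMagnetization_lt`** (`h = 0`, every `β > 0`, every `m > m*`),
  `exp_concentration_uniform_zero_field_of_spontaneousMagnetization_eq_zero`,
  **`exp_concentration_uniform_of_hasUniqueGibbsMeasure`** (uniqueness region: at `sign(h) m(β,|h|)`).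

## References

* R. S. Ellis, *Entropy, Large Deviations, and Statistical Mechanics*, Springer (1985/2006), Thm. II.6.1, Thm. II.6.3,
  §IV.5 (4.33), Thm. V.6.1. [Ellis2006]
* S. Olla, *Large deviations for Gibbs random fields*, Probab. Theory Related Fields 77 (1988) 343–357, Thm. 5.2
  (uniformity in the boundary condition). [Olla1988]
* S. Friedli, Y. Velenik, *Statistical Mechanics of Lattice Systems*, CUP (2017), Thm. 3.6 (proof: `|H^η_Λ − H^∅_Λ| ≤ 2dβ|∂Λ|`),
  §3.2.1 Exercise 3.1. [FriedliVelenik2017]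
-/

noncomputable section

namespace Summit.CriticalPhenomena.PercolationContinuityZ3.Theorems.FK

namespace IsingLargeDeviations

open MeasureTheory ProbabilityTheory Filter Topology Finset Set
open Literature.Probability.LatticeModels

/-! ### The pressure converges uniformly in the boundary condition -/

section FiniteVolume

variable {V : Type*} (G : SimpleGraph V) [DecidableEq V] [G.LocallyFinite]

/-- **`|ψ^{bc}_Λ(β,h) − ψ^∅_Λ(β,h)| ≤ |β| |∂ᵉΛ| / |Λ|`** for every boundary condition (nonempty `Λ`, any locally finite graph).
[cite: FriedliVelenik2017, Thm. 3.6 (proof)] -/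
theorem abs_pressureIn_sub_pressureIn_free_le {Λ : Finset V} (hΛ : Λ.Nonempty) (β h : ℝ) (bc : BoundaryCondition V) :
    |pressureIn G Λ β h bc - pressureIn G Λ β h .free| ≤ |β| * #(edgeBoundary G Λ) / #Λ := by
  have hpos : (0 : ℝ) < #Λ := by exact_mod_cast hΛ.card_pos
  simpa only [pressureIn] using abs_log_isingPartitionFunction_div_sub_free_div_le G Λ β h bc hpos

end FiniteVolume

variable {d : ℕ}

/-- **`ψ^{bc}_{Λ_N}(β,h) → ψ(β,h)` UNIFORMLY IN THE BOUNDARY CONDITION**: for every `ε > 0`, eventually in `N`,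
`|ψ^{bc}_{Λ_N}(β,h) − ψ(β,h)| < ε` for ALL `bc` at once (`|∂ᵉΛ_N|/|Λ_N| → 0`).
[cite: FriedliVelenik2017, Thm. 3.6; Olla1988, Thm. 5.2] -/
theorem eventually_forall_bc_abs_pressureIn_sub_pressure_lt (β h : ℝ) {ε : ℝ} (hε : 0 < ε) :
    ∀ᶠ N : ℕ in atTop, ∀ bc : BoundaryCondition (Site d),
      |pressureIn (zdGraph d) (box d N) β h bc - pressure d β h| < ε := by
  have hfree : ∀ᶠ N : ℕ in atTop, |pressureIn (zdGraph d) (box d N) β h .free - pressure d β h| < ε / 2 := by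
    have h1 := hasBoxLimit_pressureIn_holds (d := d) β h .free
    rw [HasBoxLimit, Metric.tendsto_atTop] at h1
    obtain ⟨N₀, hN₀⟩ := h1 (ε / 2) (half_pos hε)
    exact eventually_atTop.2 ⟨N₀, fun N hN => by simpa [Real.dist_eq] using hN₀ N hN⟩
  have hbd : ∀ᶠ N : ℕ in atTop, |β| * ((#(edgeBoundary (zdGraph d) (box d N)) : ℝ) / #(box d N)) < ε / 2 := by
    have h1 := ((tendsto_card_edgeBoundary_box_div d).const_mul |β|)
    rw [mul_zero] at h1
    exact h1.eventually (gt_mem_nhds (half_pos hε))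
  filter_upwards [hfree, hbd] with N h1 h2 bc
  have h3 := abs_pressureIn_sub_pressureIn_free_le (zdGraph d) (box_nonempty d N) β h bc
  rw [mul_div_assoc] at h3
  calc |pressureIn (zdGraph d) (box d N) β h bc - pressure d β h|
      = |(pressureIn (zdGraph d) (box d N) β h bc - pressureIn (zdGraph d) (box d N) β h .free) +
          (pressureIn (zdGraph d) (box d N) β h .free - pressure d β h)| := by ring_nf
    _ ≤ |pressureIn (zdGraph d) (box d N) β h bc - pressureIn (zdGraph d) (box d N) β h .free| +
          |pressureIn (zdGraph d) (box d N) β h .free - pressure d β h| := abs_add_le _ _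
    _ < ε := by linarith

/-! ### Large-deviation upper bounds with one `N₀` for all boundary conditions -/

/-- **LD UPPER BOUND, UPPER HALF-LINE, UNIFORM IN `bc`**: for `βs ≥ 0`, every `m`, `ε > 0`, eventually in `N`, for ALL
`bc`: `μ^{bc}_{Λ_N;β,h}{m|Λ_N| ≤ M_N} ≤ exp(−|Λ_N| (βsm − (ψ(β,h+s) − ψ(β,h)) − ε))`. [cite: Ellis2006, Thm. II.6.1 (b); Olla1988, Thm. 5.2] -/
theorem eventually_forall_bc_measureReal_le_sum_spinAt_le {β s : ℝ} (hβs : 0 ≤ β * s) (h m : ℝ) {ε : ℝ} (hε : 0 < ε) :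
    ∀ᶠ N : ℕ in atTop, ∀ bc : BoundaryCondition (Site d),
      (isingMeasure (zdGraph d) (box d N) β h bc).real {σ | m * #(box d N) ≤ ∑ x ∈ box d N, spinAt x σ} ≤
        Real.exp (-(#(box d N) * (β * s * m - (pressure d β (h + s) - pressure d β h) - ε))) := by
  filter_upwards [eventually_forall_bc_abs_pressureIn_sub_pressure_lt (d := d) β (h + s) (half_pos hε),
    eventually_forall_bc_abs_pressureIn_sub_pressure_lt (d := d) β h (half_pos hε)] with N h1 h2 bc
  refine (measureReal_le_sum_spinAt_le_exp_card (zdGraph d) (box_nonempty d N) hβs h bc m).trans ?_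
  rw [Real.exp_le_exp]
  have hpos : (0 : ℝ) < #(box d N) := by exact_mod_cast (box_nonempty d N).card_pos
  have ha := (abs_lt.1 (h1 bc)).2
  have hb := (abs_lt.1 (h2 bc)).1
  nlinarith

/-- **LD UPPER BOUND, LOWER HALF-LINE, UNIFORM IN `bc`**: for `βs ≥ 0`, eventually in `N`, for all `bc`,
`μ^{bc}_{Λ_N;β,h}{M_N ≤ m|Λ_N|} ≤ exp(−|Λ_N| (−βsm − (ψ(β,h−s) − ψ(β,h)) − ε))`. [cite: Ellis2006, Thm. II.6.1 (b); Olla1988, Thm. 5.2] -/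
theorem eventually_forall_bc_measureReal_sum_spinAt_le_le {β s : ℝ} (hβs : 0 ≤ β * s) (h m : ℝ) {ε : ℝ} (hε : 0 < ε) :
    ∀ᶠ N : ℕ in atTop, ∀ bc : BoundaryCondition (Site d),
      (isingMeasure (zdGraph d) (box d N) β h bc).real {σ | ∑ x ∈ box d N, spinAt x σ ≤ m * #(box d N)} ≤
        Real.exp (-(#(box d N) * (-(β * s * m) - (pressure d β (h - s) - pressure d β h) - ε))) := by
  filter_upwards [eventually_forall_bc_abs_pressureIn_sub_pressure_lt (d := d) β (h - s) (half_pos hε),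
    eventually_forall_bc_abs_pressureIn_sub_pressure_lt (d := d) β h (half_pos hε)] with N h1 h2 bc
  refine (measureReal_sum_spinAt_le_le_exp_card (zdGraph d) (box_nonempty d N) hβs h bc m).trans ?_
  rw [Real.exp_le_exp]
  have hpos : (0 : ℝ) < #(box d N) := by exact_mod_cast (box_nonempty d N).card_pos
  have ha := (abs_lt.1 (h1 bc)).2
  have hb := (abs_lt.1 (h2 bc)).1
  nlinarith

/-! ### Exponential concentration with one constant and one `N₀` for all boundary conditions -/

/-- **UPPER TAIL, UNIFORM IN `bc`**: if `β ≥ 0` and `∂⁺ψ/∂h (β,h) = D < βm` then for some `c > 0`, eventually in `N`, for ALL `bc`,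
`μ^{bc}_{Λ_N;β,h}{m|Λ_N| ≤ M_N} ≤ e^{−c|Λ_N|}`. [cite: Ellis2006, Thm. II.6.3; Olla1988, Thm. 5.2] -/
theorem upper_tail_exp_decay_uniform_of_hasDerivWithinAt {β : ℝ} (hβ : 0 ≤ β) {h D m : ℝ}
    (hD : HasDerivWithinAt (fun t => pressure d β t) D (Ici h) h) (hm : D < β * m) :
    ∃ c : ℝ, 0 < c ∧ ∀ᶠ N : ℕ in atTop, ∀ bc : BoundaryCondition (Site d),
      (isingMeasure (zdGraph d) (box d N) β h bc).real {σ | m * #(box d N) ≤ ∑ x ∈ box d N, spinAt x σ} ≤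
        Real.exp (-(c * #(box d N))) := by
  obtain ⟨s, hs, hrate⟩ := exists_rate_pos_of_hasDerivWithinAt_Ici (d := d) hD hm
  refine ⟨(β * s * m - (pressure d β (h + s) - pressure d β h)) / 2, by linarith, ?_⟩
  filter_upwards [eventually_forall_bc_measureReal_le_sum_spinAt_le (d := d) (mul_nonneg hβ hs.le) h m (half_pos hrate)]
    with N hN bc
  refine (hN bc).trans (le_of_eq ?_)
  congr 1
  ring

/-- **LOWER TAIL, UNIFORM IN `bc`**: if `β ≥ 0` and `βm < D = ∂⁻ψ/∂h (β,h)` then for some `c > 0`, eventually in `N`, for all `bc`,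
`μ^{bc}_{Λ_N;β,h}{M_N ≤ m|Λ_N|} ≤ e^{−c|Λ_N|}`. [cite: Ellis2006, Thm. II.6.3; Olla1988, Thm. 5.2] -/
theorem lower_tail_exp_decay_uniform_of_hasDerivWithinAt {β : ℝ} (hβ : 0 ≤ β) {h D m : ℝ}
    (hD : HasDerivWithinAt (fun t => pressure d β t) D (Iic h) h) (hm : β * m < D) :
    ∃ c : ℝ, 0 < c ∧ ∀ᶠ N : ℕ in atTop, ∀ bc : BoundaryCondition (Site d),
      (isingMeasure (zdGraph d) (box d N) β h bc).real {σ | ∑ x ∈ box d N, spinAt x σ ≤ m * #(box d N)} ≤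
        Real.exp (-(c * #(box d N))) := by
  obtain ⟨s, hs, hrate⟩ := exists_rate_pos_of_hasDerivWithinAt_Iic (d := d) hD hm
  refine ⟨(-(β * s * m) - (pressure d β (h - s) - pressure d β h)) / 2, by linarith, ?_⟩
  filter_upwards [eventually_forall_bc_measureReal_sum_spinAt_le_le (d := d) (mul_nonneg hβ hs.le) h m (half_pos hrate)]
    with N hN bc
  refine (hN bc).trans (le_of_eq ?_)
  congr 1
  ring

/-- **EXPONENTIAL CONCENTRATION AT `ψ'(h)/β`, UNIFORMLY IN THE BOUNDARY CONDITION** (`d ≥ 1`, `β > 0`): if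
`HasDerivAt ψ(β,·) D h` then for every `ε > 0` there are `c > 0` and `N₀` with `μ^{bc}_{Λ_N;β,h}{ε ≤ |M_N/|Λ_N| − D/β|} ≤ e^{−c|Λ_N|}`
for all `N ≥ N₀` and ALL boundary conditions. [cite: Ellis2006, Thm. II.6.3; Olla1988, Thm. 5.2 (uniformly in ω′)] -/
theorem exp_concentration_uniform_of_hasDerivAt (hd : 1 ≤ d) {β : ℝ} (hβ : 0 < β) {h D : ℝ}
    (hD : HasDerivAt (fun t => pressure d β t) D h) {ε : ℝ} (hε : 0 < ε) :
    ∃ c : ℝ, 0 < c ∧ ∀ᶠ N : ℕ in atTop, ∀ bc : BoundaryCondition (Site d),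
      (isingMeasure (zdGraph d) (box d N) β h bc).real
          {σ | ε ≤ |(∑ x ∈ box d N, spinAt x σ) / #(box d N) - D / β|} ≤ Real.exp (-(c * #(box d N))) := by
  have hup : D < β * (D / β + ε) := by
    rw [mul_add, mul_div_cancel₀ _ hβ.ne']
    linarith [mul_pos hβ hε]
  have hlow : β * (D / β - ε) < D := by
    rw [mul_sub, mul_div_cancel₀ _ hβ.ne']
    linarith [mul_pos hβ hε]
  obtain ⟨c₁, hc₁, h₁⟩ := upper_tail_exp_decay_uniform_of_hasDerivWithinAt (d := d) hβ.le hD.hasDerivWithinAt hup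
  obtain ⟨c₂, hc₂, h₂⟩ := lower_tail_exp_decay_uniform_of_hasDerivWithinAt (d := d) hβ.le hD.hasDerivWithinAt hlow
  refine ⟨min c₁ c₂ / 2, by positivity, ?_⟩
  filter_upwards [h₁, h₂, eventually_exp_add_exp_le hd hc₁ hc₂] with N hN₁ hN₂ hN bc
  exact ((measureReal_mono (setOf_le_abs_div_sub_subset (box_nonempty d N) (D / β) ε)).trans
    (measureReal_union_le _ _)).trans ((add_le_add (hN₁ bc) (hN₂ bc)).trans hN)

/-! ### The Ising specialisations, uniformly in the boundary condition -/

/-- **`h > 0`: `M_N/|Λ_N| →exp m(β,h)` UNIFORMLY IN THE BOUNDARY CONDITION** (`d ≥ 1`, `β > 0`).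
[cite: Ellis2006, Thm. V.6.1 (c); Olla1988, Thm. 5.2; FriedliVelenik2017, Thm. 3.43] -/
theorem exp_concentration_uniform_pos_field (hd : 1 ≤ d) {β h : ℝ} (hβ : 0 < β) (hh : 0 < h) {ε : ℝ} (hε : 0 < ε) :
    ∃ c : ℝ, 0 < c ∧ ∀ᶠ N : ℕ in atTop, ∀ bc : BoundaryCondition (Site d),
      (isingMeasure (zdGraph d) (box d N) β h bc).real
          {σ | ε ≤ |(∑ x ∈ box d N, spinAt x σ) / #(box d N) - magnetizationInField d β h|} ≤ Real.exp (-(c * #(box d N))) := by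
  have h1 := exp_concentration_uniform_of_hasDerivAt hd hβ (IsingSusceptibility.hasDerivAt_pressure_field (d := d) hd hβ.le hh) hε
  rwa [mul_div_cancel_left₀ _ hβ.ne'] at h1

/-- **`h = 0`, EVERY `β > 0`, every `m > m*(β)`: `μ^{bc}_{Λ_N;β,0}{M_N ≥ m|Λ_N|} ≤ e^{−c|Λ_N|}` for all `N ≥ N₀` and ALL `bc`**.
[cite: Ellis2006, Thm. V.6.1 (d); Olla1988, Thm. 5.2; FriedliVelenik2017, Prop. 3.29] -/
theorem upper_tail_exp_decay_uniform_of_spontaneousMagnetization_lt (hd : 1 ≤ d) {β : ℝ} (hβ : 0 < β) {m : ℝ}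
    (hm : spontaneousMagnetization d β < m) :
    ∃ c : ℝ, 0 < c ∧ ∀ᶠ N : ℕ in atTop, ∀ bc : BoundaryCondition (Site d),
      (isingMeasure (zdGraph d) (box d N) β 0 bc).real {σ | m * #(box d N) ≤ ∑ x ∈ box d N, spinAt x σ} ≤
        Real.exp (-(c * #(box d N))) :=
  upper_tail_exp_decay_uniform_of_hasDerivWithinAt hβ.le
    (IsingSusceptibility.hasDerivWithinAt_pressure_field_zero (d := d) hd hβ.le) (mul_lt_mul_of_pos_left hm hβ)

/-- **`h = 0`, `m*(β) = 0`: `M_N/|Λ_N| →exp 0` UNIFORMLY IN THE BOUNDARY CONDITION** (`d ≥ 1`, `β > 0`).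
[cite: Ellis2006, Thm. IV.5.5; Olla1988, Thm. 5.2; FriedliVelenik2017, Thm. 3.34] -/
theorem exp_concentration_uniform_zero_field_of_spontaneousMagnetization_eq_zero (hd : 1 ≤ d) {β : ℝ} (hβ : 0 < β)
    (hm : spontaneousMagnetization d β = 0) {ε : ℝ} (hε : 0 < ε) :
    ∃ c : ℝ, 0 < c ∧ ∀ᶠ N : ℕ in atTop, ∀ bc : BoundaryCondition (Site d),
      (isingMeasure (zdGraph d) (box d N) β 0 bc).real
          {σ | ε ≤ |(∑ x ∈ box d N, spinAt x σ) / #(box d N)|} ≤ Real.exp (-(c * #(box d N))) := by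
  have hdiff := (IsingSusceptibility.differentiableAt_pressure_zero_iff hd hβ).2 hm
  have hR := IsingSusceptibility.hasDerivWithinAt_pressure_field_zero (d := d) hd hβ.le
  have hderiv : deriv (fun t => pressure d β t) 0 = β * spontaneousMagnetization d β :=
    (uniqueDiffOn_Ici (0 : ℝ) 0 self_mem_Ici).eq_deriv _ hdiff.hasDerivAt.hasDerivWithinAt hR
  have h1 := exp_concentration_uniform_of_hasDerivAt hd hβ hdiff.hasDerivAt hε
  simpa only [hderiv, hm, mul_zero, zero_div, sub_zero] using h1

/-- **THROUGHOUT THE UNIQUENESS REGION `|𝒢(β,h)| = 1`: `M_N/|Λ_N| →exp sign(h)·m(β,|h|)` UNIFORMLY IN THE BOUNDARY CONDITION**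
(`d ≥ 1`, `β > 0`). [cite: Ellis2006, Thm. V.6.1 (c); Olla1988, Thm. 5.2; FriedliVelenik2017, Thm. 3.34 and Thm. 3.43] -/
theorem exp_concentration_uniform_of_hasUniqueGibbsMeasure (hd : 1 ≤ d) {β : ℝ} (hβ : 0 < β) {h : ℝ}
    (hU : HasUniqueGibbsMeasure (isingSpecification (zdGraph d) β h)) {ε : ℝ} (hε : 0 < ε) :
    ∃ c : ℝ, 0 < c ∧ ∀ᶠ N : ℕ in atTop, ∀ bc : BoundaryCondition (Site d),
      (isingMeasure (zdGraph d) (box d N) β h bc).real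
          {σ | ε ≤ |(∑ x ∈ box d N, spinAt x σ) / #(box d N) - (Real.sign h * magnetizationInField d β |h|)|} ≤
        Real.exp (-(c * #(box d N))) := by
  rcases lt_trichotomy h 0 with hneg | rfl | hpos
  · have h1 := exp_concentration_uniform_of_hasDerivAt hd hβ
      (IsingSusceptibility.hasDerivAt_pressure_field_of_neg (d := d) hd hβ.le hneg) hε
    rw [Real.sign_of_neg hneg, abs_of_neg hneg]
    simpa only [neg_div, mul_div_cancel_left₀ _ hβ.ne', neg_one_mul] using h1
  · have hm : spontaneousMagnetization d β = 0 :=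
      IsingSusceptibility.spontaneousMagnetization_eq_zero_of_hasUniqueGibbsMeasure (d := d) hβ.le hU
    have h1 := exp_concentration_uniform_zero_field_of_spontaneousMagnetization_eq_zero hd hβ hm hε
    simpa only [Real.sign_zero, zero_mul, sub_zero] using h1
  · have h1 := exp_concentration_uniform_pos_field hd hβ hpos hε
    rwa [Real.sign_of_pos hpos, abs_of_pos hpos, one_mul]

end IsingLargeDeviations

end Summit.CriticalPhenomena.PercolationContinuityZ3.Theorems.FK
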